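import Summits.AtomisticToContinuum.FouriersLaw.Theorems.BondHeatUncertaintyBoundedResponseBathHeatDCBand
import Summits.AtomisticToContinuum.FouriersLaw.Theorems.BondHeatUncertaintyBoundedResponseBathHeatTwistC
import HarnessLib

/-!
# BondHeatUncertainty / BoundedResponse — «DCBand» ∧ «Twist» (§T5–§T6): ★ (TV) AND (FC) ARE THEOREMS — the band door has no free input

§T5 ★ the TWISTED BATH-SIDE EINSTEIN–HELFAND IDENTITY `E[(Q^c_t)² + (Q^s_t)²] = 2γT²t − 2γ²∫₀ᵗ(t − r)cos(ωr)K_N(r)dr` for the left-bath heat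
proxy of NODE 107 (`j₀`, `e₀`, drift `γ(T − p₀²)`; `K_N = bathKinCorr`), hence `twistedBathHeatVar_nonneg`.  §T6: (TV) `twistedHeatVarNonneg` and
(FC) `spectralDeficitNonneg` (`h_N(ω) ≥ 0 ⟺ ŝ_N(ω) ≤ 2T²/γ ⟺ M_N(ω) ≥ −E_N`, every `N ≥ 2`, every `ω`) HOLD; NODE 117's door becomes
`(BDF_θ) ∧ (D) ⟹ OhmicFloor` / `(S) ∧ (BDF_θ) ⟹ 11071` (`θ > 0`) with the band floor (BDF_θ) the ONLY undecided piece, `11071 ⟺ (BDF_θ)` beneath (D),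
the rungs `θ ≤ 0` free outright, and `(S) ∧ (BNM) ⟹ 11071`, `(S) ∧ BathKernelFloor 0 (3/2) ⟹ 11071` unconditionally in (FC).
(decomp-a2c lens-1 g117, NODE 117; part 4 of 4 of the addendum; imports the node's main file `…BathHeatDCBand` and part C `…BathHeatTwistC`)

No `sorry`, no new axioms, no new definitions.
-/

noncomputable section

open MeasureTheory ProbabilityTheory Filter Topology Set Function
open scoped NNReal ENNReal
open Literature.MathematicalPhysics.KineticTheory.HeatConduction
open Literature.MathematicalPhysics.KineticTheory OscillatorChain
open Literature.Probability.Process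
open Summit.AtomisticToContinuum.FouriersLaw.Theorems.SubdiffusiveBondHeat
open Summit.AtomisticToContinuum.FouriersLaw.Theorems.SubdiffusiveBondHeat.EscapeGrading
open Summit.AtomisticToContinuum.FouriersLaw.Theorems.OddSectorIrreversibility

namespace Summit.AtomisticToContinuum.FouriersLaw.Theorems.BoundedResponse.HeatSpreading

open Summit.AtomisticToContinuum.FouriersLaw.Theorems.BoundedResponse.TransientContact
open Summit.AtomisticToContinuum.FouriersLaw.Theorems.BoundedResponse.TransientBand
open Summit.AtomisticToContinuum.FouriersLaw.Theses.BondHeatUncertainty (BoundedResponse SubdiffusiveBondHeat)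
open Summit.AtomisticToContinuum.FouriersLaw.Theses.GriffithsLimitExchange (BoundaryDEP)

/-! ## §T5 ★ The twisted bath-side Einstein–Helfand identity and the positivity of the `ω`-twisted bath heat variance -/

section BathSideTwist

variable {ω₂ lam β γ : ℝ} (hω : 0 < ω₂) (hl : 0 < lam) (hβ : 0 < β) (hγ : 0 < γ) {N : ℕ} (hN : 1 < N)
  {T : ℝ} (hT : 0 < T)
include hω hl hβ hγ hN hT

/-- ★ **THE TWISTED BATH-SIDE EINSTEIN–HELFAND IDENTITY** (`N ≥ 2`, `t ≥ 0`, any frequency `ω`): for the left-bath heat proxy data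
`j₀` (bond current `0 → 1`), `e₀` (site-`0` energy), `γ(T − p₀²)` (bath drift) of `pinnedChain_bathHeat_sq_eq`, the twisted proxies
`Q^c_t, Q^s_t` of `pinnedChain_twistedHeatProxy_sq_eq` have
`E[(Q^c_t)² + (Q^s_t)²] = 2γT²·t − 2γ² ∫₀ᵗ (t − r) cos(ωr) K_N(r) dr`
with `K_N = bathKinCorr` the kinetic kernel of the blocker's `escapeDeficit`; at `ω = 0` it is `pinnedChain_bathHeat_sq_eq`.  NEW as a typed
statement. [new; mechanism: frequency-resolved Kundu–Dhar–Narayan open-system Green–Kubo] -/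
theorem pinnedChain_twistedBathHeat_sq_eq (ω : ℝ) {t : ℝ} (ht : 0 ≤ t) :
    ∫ p, (((∫ s in (0 : ℝ)..t, Real.cos (ω * s) * (pinnedChain ω₂ lam β γ).bondCurrent N ⟨0, Nat.zero_lt_of_lt hN⟩
          ((pinnedChain ω₂ lam β γ).solMap N T T s p.1 (pairPath p.2))) +
            ω * (∫ s in (0 : ℝ)..t, Real.sin (ω * s) * ((((pinnedChain ω₂ lam β γ).solMap N T T s p.1 (pairPath p.2)).2 ⟨0, Nat.zero_lt_of_lt hN⟩) ^ 2 / 2 +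
            (pinnedChain ω₂ lam β γ).U (((pinnedChain ω₂ lam β γ).solMap N T T s p.1 (pairPath p.2)).1 ⟨0, Nat.zero_lt_of_lt hN⟩) +
            (pinnedChain ω₂ lam β γ).V (((pinnedChain ω₂ lam β γ).solMap N T T s p.1 (pairPath p.2)).1 ⟨1, hN⟩ -
              ((pinnedChain ω₂ lam β γ).solMap N T T s p.1 (pairPath p.2)).1 ⟨0, Nat.zero_lt_of_lt hN⟩) / 2)) +
            (Real.cos (ω * t) * ((((pinnedChain ω₂ lam β γ).solMap N T T t p.1 (pairPath p.2)).2 ⟨0, Nat.zero_lt_of_lt hN⟩) ^ 2 / 2 +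
            (pinnedChain ω₂ lam β γ).U (((pinnedChain ω₂ lam β γ).solMap N T T t p.1 (pairPath p.2)).1 ⟨0, Nat.zero_lt_of_lt hN⟩) +
            (pinnedChain ω₂ lam β γ).V (((pinnedChain ω₂ lam β γ).solMap N T T t p.1 (pairPath p.2)).1 ⟨1, hN⟩ -
              ((pinnedChain ω₂ lam β γ).solMap N T T t p.1 (pairPath p.2)).1 ⟨0, Nat.zero_lt_of_lt hN⟩) / 2) -
              ((p.1.2 ⟨0, Nat.zero_lt_of_lt hN⟩) ^ 2 / 2 + (pinnedChain ω₂ lam β γ).U (p.1.1 ⟨0, Nat.zero_lt_of_lt hN⟩) +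
            (pinnedChain ω₂ lam β γ).V (p.1.1 ⟨1, hN⟩ - p.1.1 ⟨0, Nat.zero_lt_of_lt hN⟩) / 2))) ^ 2 +
          ((∫ s in (0 : ℝ)..t, Real.sin (ω * s) * (pinnedChain ω₂ lam β γ).bondCurrent N ⟨0, Nat.zero_lt_of_lt hN⟩
          ((pinnedChain ω₂ lam β γ).solMap N T T s p.1 (pairPath p.2))) -
            ω * (∫ s in (0 : ℝ)..t, Real.cos (ω * s) * ((((pinnedChain ω₂ lam β γ).solMap N T T s p.1 (pairPath p.2)).2 ⟨0, Nat.zero_lt_of_lt hN⟩) ^ 2 / 2 +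
            (pinnedChain ω₂ lam β γ).U (((pinnedChain ω₂ lam β γ).solMap N T T s p.1 (pairPath p.2)).1 ⟨0, Nat.zero_lt_of_lt hN⟩) +
            (pinnedChain ω₂ lam β γ).V (((pinnedChain ω₂ lam β γ).solMap N T T s p.1 (pairPath p.2)).1 ⟨1, hN⟩ -
              ((pinnedChain ω₂ lam β γ).solMap N T T s p.1 (pairPath p.2)).1 ⟨0, Nat.zero_lt_of_lt hN⟩) / 2)) +
            Real.sin (ω * t) * ((((pinnedChain ω₂ lam β γ).solMap N T T t p.1 (pairPath p.2)).2 ⟨0, Nat.zero_lt_of_lt hN⟩) ^ 2 / 2 +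
            (pinnedChain ω₂ lam β γ).U (((pinnedChain ω₂ lam β γ).solMap N T T t p.1 (pairPath p.2)).1 ⟨0, Nat.zero_lt_of_lt hN⟩) +
            (pinnedChain ω₂ lam β γ).V (((pinnedChain ω₂ lam β γ).solMap N T T t p.1 (pairPath p.2)).1 ⟨1, hN⟩ -
              ((pinnedChain ω₂ lam β γ).solMap N T T t p.1 (pairPath p.2)).1 ⟨0, Nat.zero_lt_of_lt hN⟩) / 2)) ^ 2)
      ∂(((pinnedChain ω₂ lam β γ).gibbsMeasure N T).prod wienerPair) =
      2 * γ * T ^ 2 * t - 2 * γ ^ 2 * ∫ r in (0 : ℝ)..t, (t - r) * (Real.cos (ω * r) * bathKinCorr ω₂ lam β γ T N r) := by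
  -- the three observables (verbatim from `pinnedChain_bathHeat_sq_eq`)
  have hUc : Continuous (pinnedChain ω₂ lam β γ).U := (pinnedChain_contDiff_U ω₂ lam β γ (n := 0)).continuous
  have hVc : Continuous (pinnedChain ω₂ lam β γ).V := (pinnedChain_contDiff_V ω₂ lam β γ (n := 0)).continuous
  have hp0 : Continuous fun y : PhaseSpace N => y.2 ⟨0, Nat.zero_lt_of_lt hN⟩ := by fun_prop
  have hq0 : Continuous fun y : PhaseSpace N => y.1 ⟨0, Nat.zero_lt_of_lt hN⟩ := by fun_prop
  have hq1 : Continuous fun y : PhaseSpace N => y.1 ⟨1, hN⟩ := by fun_prop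
  have hjm : Measurable ((pinnedChain ω₂ lam β γ).bondCurrent N ⟨0, Nat.zero_lt_of_lt hN⟩) :=
    (pinnedChain_continuous_bondCurrent ω₂ lam β γ N _).measurable
  have hem : Measurable (fun y : PhaseSpace N => (y.2 ⟨0, Nat.zero_lt_of_lt hN⟩) ^ 2 / 2 +
      (pinnedChain ω₂ lam β γ).U (y.1 ⟨0, Nat.zero_lt_of_lt hN⟩) +
      (pinnedChain ω₂ lam β γ).V (y.1 ⟨1, hN⟩ - y.1 ⟨0, Nat.zero_lt_of_lt hN⟩) / 2) :=
    ((((hp0.pow 2).div_const 2).add (hUc.comp hq0)).add ((hVc.comp (hq1.sub hq0)).div_const 2)).measurable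
  have hφm : Measurable (fun y : PhaseSpace N => γ * (T - (y.2 ⟨0, Nat.zero_lt_of_lt hN⟩) ^ 2)) :=
    (continuous_const.mul (continuous_const.sub (hp0.pow 2))).measurable
  have hj2 := pinnedChain_integrable_sq_bondCurrent hω hl.le hβ.le γ N hT ⟨0, Nat.zero_lt_of_lt hN⟩
  have he2 := pinnedChain_integrable_sq_siteEnergy hω hl.le hβ.le γ N hT hN
  have hφ2 := pinnedChain_integrable_sq_kineticDeviation hω hl.le hβ.le γ N hT γ T ⟨0, Nat.zero_lt_of_lt hN⟩
  have hjo : ∀ y : PhaseSpace N, (pinnedChain ω₂ lam β γ).bondCurrent N ⟨0, Nat.zero_lt_of_lt hN⟩ (y.1, -y.2) =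
      -1 * (pinnedChain ω₂ lam β γ).bondCurrent N ⟨0, Nat.zero_lt_of_lt hN⟩ y := fun y => by
    rw [OscillatorChain.bondCurrent_neg_momentum]; ring
  have hee : ∀ y : PhaseSpace N, ((y.1, -y.2).2 ⟨0, Nat.zero_lt_of_lt hN⟩) ^ 2 / 2 +
      (pinnedChain ω₂ lam β γ).U ((y.1, -y.2).1 ⟨0, Nat.zero_lt_of_lt hN⟩) +
      (pinnedChain ω₂ lam β γ).V ((y.1, -y.2).1 ⟨1, hN⟩ - (y.1, -y.2).1 ⟨0, Nat.zero_lt_of_lt hN⟩) / 2 =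
      1 * ((y.2 ⟨0, Nat.zero_lt_of_lt hN⟩) ^ 2 / 2 + (pinnedChain ω₂ lam β γ).U (y.1 ⟨0, Nat.zero_lt_of_lt hN⟩) +
        (pinnedChain ω₂ lam β γ).V (y.1 ⟨1, hN⟩ - y.1 ⟨0, Nat.zero_lt_of_lt hN⟩) / 2) := fun y => by
    simp only [Pi.neg_apply, neg_sq, one_mul]
  have hφe : ∀ y : PhaseSpace N, γ * (T - ((y.1, -y.2).2 ⟨0, Nat.zero_lt_of_lt hN⟩) ^ 2) =
      1 * (γ * (T - (y.2 ⟨0, Nat.zero_lt_of_lt hN⟩) ^ 2)) := fun y => by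
    simp only [Pi.neg_apply, neg_sq, one_mul]
  have hdyn := stub_siteEnergyDynkin ω₂ lam β γ hω hl hβ hγ T hT N hN
  have h := pinnedChain_twistedHeatProxy_sq_eq hω hl hβ hγ hN hT hjm hem hφm hj2 he2 hφ2 hjo hee hφe hdyn ω ht
  rw [h, spair_siteEnergy_deficit_eq hω hl hβ hγ hN hT, intervalIntegral.integral_congr
    (fun r _ => by rw [kpair_bathDrift_eq hN r])]
  have hc : ∫ r in (0 : ℝ)..t, (t - r) * (Real.cos (ω * r) * (γ ^ 2 * bathKinCorr ω₂ lam β γ T N r)) =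
      γ ^ 2 * ∫ r in (0 : ℝ)..t, (t - r) * (Real.cos (ω * r) * bathKinCorr ω₂ lam β γ T N r) := by
    rw [← intervalIntegral.integral_const_mul]
    exact intervalIntegral.integral_congr fun r _ => by ring
  rw [hc]
  ring

/-- ★ **The free input of the band door, PROVED: the `ω`-twisted bath heat variance is nonnegative** —
`γ² ∫₀ᵗ (t − r) cos(ωr) K_N(r) dr ≤ γT²·t` for all `t ≥ 0`, `N ≥ 2` and every frequency `ω` (a sum of two second moments is
nonnegative).  At `ω = 0` it is the tree's `bathHeatVar_nonneg`. [new] -/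
theorem twistedBathHeatVar_nonneg (ω : ℝ) {t : ℝ} (ht : 0 ≤ t) :
    0 ≤ 2 * γ * T ^ 2 * t - 2 * γ ^ 2 * ∫ r in (0 : ℝ)..t, (t - r) * (Real.cos (ω * r) * bathKinCorr ω₂ lam β γ T N r) := by
  rw [← pinnedChain_twistedBathHeat_sq_eq hω hl hβ hγ hN hT ω ht]
  exact integral_nonneg fun p => by positivity

end BathSideTwist

/-! ## §T6 Consequences for NODE 117: (TV) and (FC) are THEOREMS; the band door has no free input left -/

/-- ★ **(TV) `TwistedHeatVarNonneg` HOLDS** (the `ω`-twist of NODE 107's `bathHeatVar_nonneg`). [new; this cell] -/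
theorem twistedHeatVarNonneg : TwistedHeatVarNonneg := by
  intro ω₂ lam β γ hω hl hβ hγ T hT N hN ω t ht
  rw [twistedHeatVar]
  exact twistedBathHeatVar_nonneg hω hl hβ hγ (lt_of_lt_of_le one_lt_two hN) hT ω ht

/-- ★ **(FC) `SpectralDeficitNonneg` HOLDS**: `h_N(ω) ≥ 0` — the kinetic spectrum at the contact never exceeds the white bath level,
`ŝ_N(ω) = 2∫₀^∞ cos(ωu) K_N(u) du ≤ 2T²/γ` for every `N ≥ 2` and every frequency `ω` (its `ω = 0` instance is the tree's `escapeDeficit_nonneg`).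
[new; this cell: twisted KDN identity + affine Fejér limit] -/
theorem spectralDeficitNonneg : SpectralDeficitNonneg :=
  spectralDeficitNonneg_of_twistedHeatVarNonneg twistedHeatVarNonneg

/-- (FC) in census currency: `(γ/T²)∫_{(0,∞)} cos(ωu) K_N(u) du ≤ 1`. [new] -/
theorem integral_cos_mul_bathKinCorr_le {ω₂ lam β γ : ℝ} (hω : 0 < ω₂) (hl : 0 < lam) (hβ : 0 < β) (hγ : 0 < γ) {T : ℝ} (hT : 0 < T)
    {N : ℕ} (hN : 2 ≤ N) (ω : ℝ) :
    γ / T ^ 2 * ∫ u in Ioi (0 : ℝ), Real.cos (ω * u) * bathKinCorr ω₂ lam β γ T N u ≤ 1 := by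
  have h := spectralDeficitNonneg ω₂ lam β γ hω hl hβ hγ T hT N hN ω
  rw [spectralDeficit] at h
  linarith

/-- (FC) as the Warburg-dip floor `M_N(ω) ≥ −E_N` for every `ω` (no hypothesis left). [new] -/
theorem neg_escapeDeficit_le_warburgDip :
    ∀ ω₂ lam β γ : ℝ, 0 < ω₂ → 0 < lam → 0 < β → 0 < γ → ∀ T : ℝ, 0 < T → ∀ N : ℕ, 2 ≤ N → ∀ ω : ℝ,
      -escapeDeficit ω₂ lam β γ T N ≤ warburgDip ω₂ lam β γ T N ω :=
  neg_escapeDeficit_le_warburgDip_of_spectralDeficitNonneg spectralDeficitNonneg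

/-- ★ **THE DOOR OF NODE 117 WITHOUT FREE INPUT: `(BDF_θ) ∧ (D) ⟹ OhmicFloor`** (`θ > 0`). [new; this cell] -/
theorem ohmicFloor_of_bandDeficitFloor_deficitCesaroPoint {θ : ℝ} (hθ : 0 < θ) (hB : BandDeficitFloor θ) (hD : DeficitCesaroPoint) :
    OhmicFloor :=
  ohmicFloor_of_deficitCesaroPoint_bandDeficitFloor hθ spectralDeficitNonneg hB hD

/-- ★ **Beneath (S): `(S) ∧ (BDF_θ) ⟹ 11071`** (`θ > 0`) — one UNDECIDED piece, the band floor, remains. [new; this cell] -/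
theorem boundedResponse_of_subdiffusiveBondHeat_bandDeficitFloor' {θ : ℝ} (hθ : 0 < θ) (hS : SubdiffusiveBondHeat)
    (hB : BandDeficitFloor θ) : BoundedResponse :=
  boundedResponse_of_subdiffusiveBondHeat_bandDeficitFloor hθ hS spectralDeficitNonneg hB

/-- **Exactness beneath (D) alone: `11071 ⟺ (BDF_θ)`** for every `θ > 0`. [new; this cell] -/
theorem boundedResponse_iff_bandDeficitFloor' {θ : ℝ} (hθ : 0 < θ) (hD : DeficitCesaroPoint) : BoundedResponse ↔ BandDeficitFloor θ :=
  boundedResponse_iff_bandDeficitFloor hθ spectralDeficitNonneg hD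

/-- **Exactness beneath (S): `11071 ⟺ (BDF_θ)`** for every `θ > 0`. [new; this cell] -/
theorem boundedResponse_iff_bandDeficitFloor_of_subdiffusiveBondHeat' {θ : ℝ} (hθ : 0 < θ) (hS : SubdiffusiveBondHeat) :
    BoundedResponse ↔ BandDeficitFloor θ :=
  boundedResponse_iff_bandDeficitFloor_of_subdiffusiveBondHeat hθ hS spectralDeficitNonneg

/-- Necessity with no hypothesis but the blocker: `OhmicFloor ⟹ (BDF_θ)` for every `θ ≥ 0`. [new] -/
theorem bandDeficitFloor_of_ohmicFloor' {θ : ℝ} (hθ : 0 ≤ θ) (hO : OhmicFloor) : BandDeficitFloor θ :=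
  bandDeficitFloor_of_ohmicFloor hθ spectralDeficitNonneg hO

/-- The free rungs: `(BDF_θ)` holds outright for every `θ ≤ 0`. [new] -/
theorem bandDeficitFloor_of_nonpos' {θ : ℝ} (hθ : θ ≤ 0) : BandDeficitFloor θ :=
  bandDeficitFloor_of_nonpos hθ spectralDeficitNonneg

/-- Saturation, unconditional form: for `θ > 1`, `(BDF_θ) ⟺ OhmicFloor`. [new] -/
theorem bandDeficitFloor_iff_ohmicFloor_of_one_lt' {θ : ℝ} (hθ : 1 < θ) : BandDeficitFloor θ ↔ OhmicFloor :=
  bandDeficitFloor_iff_ohmicFloor_of_one_lt hθ spectralDeficitNonneg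

/-- The weakest time-side supplier, unconditional form: `(S) ∧ (BNM) ⟹ 11071`. [new] -/
theorem boundedResponse_of_subdiffusiveBondHeat_bandNegMass' (hS : SubdiffusiveBondHeat) (hQ : BandNegMass) : BoundedResponse :=
  boundedResponse_of_subdiffusiveBondHeat_bandNegMass hS spectralDeficitNonneg hQ

/-- The kernel-floor supplier via the band, unconditional form: `(S) ∧ BathKernelFloor 0 (3/2) ⟹ 11071`.  STATEMENT ALREADY IN THE TREE as
`…BathHeatLateTail.boundedResponse_of_subdiffusiveBondHeat_bathKernelFloor_viaLate` (the late-tail route, byte-identical signature); kept as an `example`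
recording the BAND-route proof (lane edit hand-2 g42 on `dedup.landed`: the lens's `…_viaBand'` declaration dropped, cite the tree name). [formal bookkeeping] -/
example (hS : SubdiffusiveBondHeat) (hK : BathKernelFloor 0 (3 / 2)) : BoundedResponse :=
  boundedResponse_of_subdiffusiveBondHeat_bathKernelFloor_viaBand hS spectralDeficitNonneg hK

end Summit.AtomisticToContinuum.FouriersLaw.Theorems.BoundedResponse.HeatSpreading

end
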